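import Mathlib
import HarnessLib
import Summits.CriticalPhenomena.CardyFormulaZ2.Theorems.CardyComplexConeDefs
import Literature.Probability.LatticeModels.CellGridSaddleSymmetry
import Literature.Probability.Percolation.BondPercolationSymmetry

/-!
# Rotation covariance, definitions: the quarter turn about a lattice point
(line `Sketch`, composition `LeeYang`, crux `EdgeCoherence`, item stmt-CriticalPhenomena-11385)

Route `CardyComplexCone` (sub-problem `CriticalPhenomena/CardyFormulaZ2`), crux
`Summit.CriticalPhenomena.CardyFormulaZ2.Theses.CardyComplexCone.EdgeCoherence`. Definitions module of the
lead's reformulation of the crux by the EXACT `ℤ₄` SYMMETRY of `ℤ²`, of `P_{1/2}` and of the exploration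
rules (lead `prover-line-stmt-CriticalPhenomena-11385-c2-0`): rotating the Dobrushin DATA (domain and arcs)
by a quarter turn about a lattice point `v` maps class-`c` darts at `w` to class-`(c+1)` darts at
`rotAbout v w` with the same winding, so `EdgeCoherence` with `u ≡ 1` reads "the deep corner observable
forgets a quarter turn of the far-away boundary data" — the rotational twin of the translational
statement `EdgePrecompact` (ii) (item stmt-CriticalPhenomena-11387, `shiftData`,
`medialExploration_shiftData`).

* `rotAbout v : Site 2 ≃ Site 2` — the quarter turn of `ℤ²` about the lattice point `v`,
  `x ↦ v + R (x − v)` with `R (a, b) = (−b, a)` the tree's quarter turn about the origin `rotCell`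
  (`Literature/Probability/LatticeModels/CellGridSaddleSymmetry.lean`; no separate `rotSite` is introduced);
  `rotAbout v = shift v ∘ R ∘ shift (−v)` (`rotAbout_eq_shift_rotCell_shift`, and the induced forms
  on pairs, configurations and paths: `sym2Equiv_rotAbout_apply`, `relabel_rotAbout`, `map_rotAbout`);
* `rotIso v : zdGraph 2 ≃g zdGraph 2` — the same map as a graph automorphism of `ℤ²`, whence the
  invariance of `P_p` (`bondPercolation_map_relabel_rotAbout`, Grimmett 1999 §1.6);
* `rotPlane c : ℂ → ℂ` — the quarter turn of the plane about `c`, `z ↦ c + i (z − c)` (an isometry fixing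
  `c`; `image_rotPlane`: on sets it is `(c + ·) ∘ (i ·) ∘ (−c + ·)`), and the registered anchor
  `meshPoint_rotAbout : δ · rotAbout v x = rotPlane (δ v) (δ x)`;
* `rotData E v` — Dobrushin data with domain and both arcs turned by `rotPlane (meshPoint E.δ v)`, same mesh
  (the rotational twin of `shiftData`), and its conjugation form
  `rotData E v = shiftData ⟨i·Ω', δ, i·A', i·B'⟩ v` with `⟨Ω', δ, A', B'⟩ = shiftData E (−v)`
  (`rotData_eq_shiftData`), which reduces every covariance statement about `v` to the tree's quarter-turn
  dictionary about the origin (`…CardySelfRefinementLagHandOffRotationCorners/…RotationData`,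
  `…CardyComplexConeCoherentMoreraCoherenceShift`) and the translation dictionary
  (`…CardyComplexConeEdgePrecompactMedialExplorationShiftData`).

Nothing is asserted: four definitions and elementary identities, all proved. The path-level covariance
`medialExploration_rotData` is the companion file `…EdgeCoherenceMedialExplorationRotData.lean`.

Sources: G. Grimmett, *Percolation*, 2nd ed. (1999), §1.6 (lattice symmetries of `P_p`); S. Smirnov,
C. R. Acad. Sci. Paris 333 (2001), §2 (the exploration path); B. Bollobás, O. Riordan, *Percolation* (2006),
Ch. 3 ("by symmetry").
-/

noncomputable section

namespace Summit.CriticalPhenomena.CardyFormulaZ2.Cruxes.EdgeCoherence.Rotation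

open scoped Pointwise
open Set MeasureTheory
open Literature.Probability.LatticeModels Literature.Probability.Percolation
open Summit.CriticalPhenomena.CardyFormulaZ2.Cruxes.EdgePrecompact.QkzStripBoundaryArm (shiftData meshPoint_neg)

/-! ### The quarter turn of `ℤ²` about a lattice point -/

/-- **The quarter turn of `ℤ²` about the lattice point `v`**: `x ↦ v + R (x − v)`, where
`R (a, b) = (−b, a)` is the tree's quarter turn about the origin `rotCell`
(`CellGridSaddleSymmetry.lean`; the `rotSite` of the line's notes). A bijection fixing `v`
(`rotAbout_self`); conjugate of `rotCell` by the translation `Site.shift v`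
(`rotAbout_eq_shift_rotCell_shift`). -/
def rotAbout (v : Site 2) : Site 2 ≃ Site 2 :=
  ((Equiv.subRight v).trans rotCell).trans (Equiv.addLeft v)

/-- `rotAbout v x = v + R (x − v)`. -/
theorem rotAbout_apply (v x : Site 2) : rotAbout v x = v + rotCell (x - v) := rfl

/-- First coordinate of the turned site: `v₀ + v₁ − x₁`. -/
@[simp] theorem rotAbout_apply_zero (v x : Site 2) : rotAbout v x 0 = v 0 + v 1 - x 1 := by
  simp only [rotAbout_apply, Pi.add_apply, rotCell_apply_zero, Pi.sub_apply]
  ring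

/-- Second coordinate of the turned site: `v₁ − v₀ + x₀`. -/
@[simp] theorem rotAbout_apply_one (v x : Site 2) : rotAbout v x 1 = v 1 - v 0 + x 0 := by
  simp only [rotAbout_apply, Pi.add_apply, rotCell_apply_one, Pi.sub_apply]
  ring

/-- The centre is fixed. -/
theorem rotAbout_self (v : Site 2) : rotAbout v v = v := by
  ext i
  fin_cases i
  · rw [Fin.zero_eta, rotAbout_apply_zero]; ring
  · rw [Fin.mk_one, rotAbout_apply_one]; ring

/-- About the origin the turn is `rotCell`. -/
theorem rotAbout_zero_apply (x : Site 2) : rotAbout 0 x = rotCell x := by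
  rw [rotAbout_apply, sub_zero, zero_add]

/-- **Conjugation form**: `rotAbout v = shift v ∘ R ∘ shift (−v)`. -/
theorem rotAbout_eq_shift_rotCell_shift (v x : Site 2) :
    rotAbout v x = Site.shift v (rotCell (Site.shift (-v) x)) := by
  rw [rotAbout_apply, Site.shift_apply, Site.shift_apply, ← sub_eq_add_neg, add_comm]

/-- The inverse turn in coordinates: `(rotAbout v)⁻¹ x = v + R⁻¹ (x − v)`. -/
theorem rotAbout_symm_apply (v x : Site 2) : (rotAbout v).symm x = v + rotCell.symm (x - v) := by
  rw [Equiv.symm_apply_eq, rotAbout_apply, add_sub_cancel_left, Equiv.apply_symm_apply, add_sub_cancel]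

/-- Conjugation form on unordered pairs (medial vertices / bonds). -/
theorem sym2Equiv_rotAbout_apply (v : Site 2) (e : Sym2 (Site 2)) :
    sym2Equiv (rotAbout v) e =
      sym2Equiv (Site.shift v) (sym2Equiv rotCell (sym2Equiv (Site.shift (-v)) e)) := by
  induction e using Sym2.ind with
  | h x y => simp only [sym2Equiv_mk, rotAbout_eq_shift_rotCell_shift]

/-- Conjugation form on bond configurations: turning about `v` is shifting by `−v`, turning about
the origin and shifting back. -/
theorem relabel_rotAbout (v : Site 2) (ω : BondConfig (Site 2)) :
    BondConfig.relabel (sym2Equiv (rotAbout v)) ω =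
      BondConfig.relabel (sym2Equiv (Site.shift v)) (BondConfig.relabel (sym2Equiv rotCell)
        (BondConfig.relabel (sym2Equiv (Site.shift (-v))) ω)) := by
  simp only [BondConfig.relabel_apply, Set.image_image]
  exact Set.image_congr' fun e => sym2Equiv_rotAbout_apply v e

/-- Conjugation form on lists of medial vertices (paths). -/
theorem map_rotAbout (v : Site 2) (l : List (Sym2 (Site 2))) :
    l.map (sym2Equiv (rotAbout v)) =
      ((l.map (sym2Equiv (Site.shift (-v)))).map (sym2Equiv rotCell)).map
        (sym2Equiv (Site.shift v)) := by
  simp only [List.map_map]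
  exact List.map_congr_left fun e _ => sym2Equiv_rotAbout_apply v e

/-- **The quarter turn about `v` as a graph automorphism of `ℤ²`** (for the invariance of `P_p`,
`bondPercolation_map_relabel_iso`). -/
def rotIso (v : Site 2) : zdGraph 2 ≃g zdGraph 2 where
  toEquiv := rotAbout v
  map_rel_iff' := fun {a b} => by
    show (zdGraph 2).Adj (rotAbout v a) (rotAbout v b) ↔ (zdGraph 2).Adj a b
    rw [rotAbout_eq_shift_rotCell_shift, rotAbout_eq_shift_rotCell_shift, zdGraph_adj_shift_iff]
    exact (CellSymmetry.rot.zdGraph_adj_cell _ _).trans (zdGraph_adj_shift_iff (-v) a b)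

/-- `rotIso v` acts by `rotAbout v`. -/
@[simp] theorem rotIso_apply (v x : Site 2) : rotIso v x = rotAbout v x := rfl

/-- The underlying bijection of `rotIso v` is `rotAbout v`. -/
theorem rotIso_toEquiv (v : Site 2) : (rotIso v).toEquiv = rotAbout v := rfl

/-- Lattice adjacency is invariant under the quarter turn about `v`. -/
theorem zdGraph_adj_rotAbout_iff (v x y : Site 2) :
    (zdGraph 2).Adj (rotAbout v x) (rotAbout v y) ↔ (zdGraph 2).Adj x y :=
  (rotIso v).map_rel_iff'

/-- **`P_p` on `ℤ²` is invariant under the quarter turn about a lattice point** (Grimmett 1999,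
§1.6: `rotIso v` is a graph automorphism). -/
theorem bondPercolation_map_relabel_rotAbout (v : Site 2) (p : unitInterval) :
    (bondPercolation (zdGraph 2) p).map (BondConfig.relabel (sym2Equiv (rotAbout v))) =
      bondPercolation (zdGraph 2) p :=
  bondPercolation_map_relabel_iso (rotIso v) p

/-! ### The quarter turn of the plane about a point -/

/-- **The quarter turn of the plane about `c`**: `z ↦ c + i (z − c)` (an isometry fixing `c`). -/
def rotPlane (c z : ℂ) : ℂ := c + Complex.I * (z - c)

/-- `rotPlane`, unfolded. -/
theorem rotPlane_apply (c z : ℂ) : rotPlane c z = c + Complex.I * (z - c) := rfl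

/-- The centre is fixed. -/
theorem rotPlane_self (c : ℂ) : rotPlane c c = c := by simp [rotPlane]

/-- About the origin the turn is multiplication by `i`. -/
theorem rotPlane_zero_apply (z : ℂ) : rotPlane 0 z = Complex.I * z := by simp [rotPlane]

/-- The quarter turn about `c` preserves distances. -/
theorem dist_rotPlane (c z w : ℂ) : dist (rotPlane c z) (rotPlane c w) = dist z w := by
  rw [Complex.dist_eq, Complex.dist_eq, rotPlane, rotPlane,
    show c + Complex.I * (z - c) - (c + Complex.I * (w - c)) = Complex.I * (z - w) by ring, norm_mul,
    Complex.norm_I, one_mul]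

/-- The quarter turn about `c` is an isometry of `ℂ`. -/
theorem isometry_rotPlane (c : ℂ) : Isometry (rotPlane c) :=
  Isometry.of_dist_eq (dist_rotPlane c)

/-- **Conjugation form**: `rotPlane c = (c + ·) ∘ (i ·) ∘ (−c + ·)` on sets. -/
theorem image_rotPlane (c : ℂ) (S : Set ℂ) :
    rotPlane c '' S = c +ᵥ ((fun z => Complex.I * z) '' (-c +ᵥ S)) := by
  rw [← Set.image_vadd, ← Set.image_vadd, Set.image_image, Set.image_image]
  refine Set.image_congr' fun z => ?_
  simp only [rotPlane, vadd_eq_add]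
  ring

/-- **The lattice turn acts on mesh points as the plane turn** (registered anchor sub-goal of this
definitions module): `δ · rotAbout v x = rotPlane (δ v) (δ x)`. -/
theorem meshPoint_rotAbout : ∀ (δ : ℝ) (v x : Site 2), meshPoint δ (rotAbout v x) = rotPlane (meshPoint δ v) (meshPoint δ x) := by
  intro δ v x
  apply Complex.ext
  · simp [rotPlane, meshPoint_re, meshPoint_im]
    ring
  · simp [rotPlane, meshPoint_re, meshPoint_im]
    ring

/-! ### Turned Dobrushin data -/

/-- **Dobrushin data turned by a quarter turn about the lattice point `v`** (at their own mesh):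
domain and both arcs turned by `rotPlane (meshPoint E.δ v)`, same mesh. The rotational twin of
`shiftData` (translations); a class-`c` corner `(w, faceAt w c)` of `E` corresponds to the
class-`(c+1)` corner `(rotAbout v w, faceAt (rotAbout v w) (c + 1))` of `rotData E v`. -/
def rotData (E : DiscreteDobrushin) (v : Site 2) : DiscreteDobrushin where
  Ω := rotPlane (meshPoint E.δ v) '' E.Ω
  δ := E.δ
  arcA := rotPlane (meshPoint E.δ v) '' E.arcA
  arcB := rotPlane (meshPoint E.δ v) '' E.arcB

/-- The domain of the turned data. -/
@[simp] theorem rotData_Ω (E : DiscreteDobrushin) (v : Site 2) :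
    (rotData E v).Ω = rotPlane (meshPoint E.δ v) '' E.Ω := rfl

/-- The mesh of the turned data. -/
@[simp] theorem rotData_δ (E : DiscreteDobrushin) (v : Site 2) : (rotData E v).δ = E.δ := rfl

/-- The arc `A` of the turned data. -/
@[simp] theorem rotData_arcA (E : DiscreteDobrushin) (v : Site 2) :
    (rotData E v).arcA = rotPlane (meshPoint E.δ v) '' E.arcA := rfl

/-- The arc `B` of the turned data. -/
@[simp] theorem rotData_arcB (E : DiscreteDobrushin) (v : Site 2) :
    (rotData E v).arcB = rotPlane (meshPoint E.δ v) '' E.arcB := rfl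

/-- **Conjugation form on data**: turning about `v` is shifting by `−v`, turning about the origin
(domain and arcs multiplied by `i`, the form of the tree's quarter-turn dictionary
`…CardySelfRefinementLagHandOffRotationData`) and shifting back by `v`. -/
theorem rotData_eq_shiftData (E : DiscreteDobrushin) (v : Site 2) :
    rotData E v = shiftData ⟨(fun z => Complex.I * z) '' (shiftData E (-v)).Ω, (shiftData E (-v)).δ,
      (fun z => Complex.I * z) '' (shiftData E (-v)).arcA,
      (fun z => Complex.I * z) '' (shiftData E (-v)).arcB⟩ v := by
  simp only [rotData, shiftData, image_rotPlane, meshPoint_neg]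

end Summit.CriticalPhenomena.CardyFormulaZ2.Cruxes.EdgeCoherence.Rotation

end
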